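import Summits.RiemannHypothesis.RiemannHypothesis.Theorems.WeilGroundStateGroundStatesConvergeToXiHarmonicClosure
import Summits.RiemannHypothesis.RiemannHypothesis.Theorems.WeilGroundStateGroundStatesConvergeToXiStubPhiTranslateHarmonic
import Summits.RiemannHypothesis.RiemannHypothesis.Theorems.WeilGroundStateGroundStatesConvergeToXiStubPhiIteratedDerivEnvelope
import Summits.RiemannHypothesis.RiemannHypothesis.Theorems.WeilGroundStateGroundStatesConvergeToXiStubPsiDecay
import Summits.RiemannHypothesis.RiemannHypothesis.Theorems.WeilGroundStateGroundStatesConvergeToXiStubMellinXi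
import Summits.RiemannHypothesis.RiemannHypothesis.Theorems.WeilGroundStateGroundStatesConvergeToXiLineExactMoments
import Literature.NumberTheory.LFunctions.WeilExplicit
import Literature.NumberTheory.LFunctions.WeilExplicitFormulaProofs
import Literature.NumberTheory.LFunctions.WeilMellinBounds
import Literature.NumberTheory.LFunctions.RiemannXiFourier
import Literature.NumberTheory.LFunctions.RiemannXi
import Literature.NumberTheory.LFunctions.RiemannXiHadamardProduct
import Literature.Analysis.Complex.StripResidueFormula
import Mathlib.Analysis.Calculus.IteratedDeriv.Lemmas
import Mathlib.Analysis.SpecialFunctions.Trigonometric.DerivHyp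
import Mathlib.MeasureTheory.Group.Integral
import HarnessLib

/-!
# `WeilGroundState.GroundStatesConvergeToXi` — the symmetrised translate of Riemann's kernel is
Weil-harmonic but not a multiple of the kernel
(crux item stmt-RiemannHypothesis-1527, route route-RiemannHypothesis-WeilGroundState; line `Sketch`,
stub `stub_phi_translateAvg_harmonic` (H6); `--supports`; RH-free)

With `Φ(t) = 2Ψ(2t)` Riemann's kernel (`LagariasMontague.Psic`; `Φ̂ = weilMellin Φ = ξ` by
`stub_mellinXi`, and `Φ` is WEIL-HARMONIC, `W(Φ ⋆ g̃) = 0` for every test `g`, `phi_conv_harmonic`),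
the SYMMETRISED TRANSLATE
`v_x(t) := (Φ(t + x) + Φ(t - x))/2 = Ψ(2(t + x)) + Ψ(2(t - x))`
is the NON-RIGIDITY WITNESS of the line: it shares every structural property of `Φ` visible to the
explicit formula —
* it is real, positive, even and smooth;
* all its derivatives are `O(e^{-|t|})` (`stub_phi_iteratedDeriv_envelope` + translation), and
  `v_x = O(e^{-b|t|})` for EVERY rate `b` (`stub_psiDecay`);
* `v̂_x(s) = cosh((s - 1/2)x) ξ(s)` (`phiTr_weilMellin` at `±x`), which vanishes at every
  non-trivial zero of `ζ`;
* hence `W(v_x ⋆ g̃) = 0` for every test `g` (strong-class pairing `stub_strongClass_pairing` +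
  the class explicit formula `explicit_formula_expClass'`);
yet for `x ≠ 0` it is NOT a multiple of `Φ`: `v̂_x = c ξ` would force `c = 1` at `s = 1/2`
(`ξ(1/2) ≠ 0`) and `cosh(x/2) = 1` at `s = 0` (`ξ(0) = 1/2`), i.e. `x = 0`.

No new definitions; no named fact is used.
-/

noncomputable section

set_option linter.dupNamespace false

open scoped Topology Real ComplexConjugate
open Filter Set MeasureTheory Complex

namespace Summit.RiemannHypothesis.RiemannHypothesis.Theorems.GroundStatesConvergeToXi

open Literature.NumberTheory.LFunctions

/-! ## Algebra of the two translates -/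

/-- `Ψ(2(t + x₀)) = ½ Φ(t + x₀)` as functions. [folklore] -/
theorem phiAvg_psicTr_eq (x₀ : ℝ) :
    (fun t : ℝ => LagariasMontague.Psic (2 * (t + x₀))) =
      fun t : ℝ => (1 / 2 : ℂ) * ((2 : ℂ) * LagariasMontague.Psic (2 * (t + x₀))) := by
  funext t
  ring

/-- `t - x = t + (-x)` inside the kernel, as functions. [folklore] -/
theorem phiAvg_psicTr_sub_eq (x : ℝ) :
    (fun t : ℝ => LagariasMontague.Psic (2 * (t - x))) =
      fun t : ℝ => LagariasMontague.Psic (2 * (t + -x)) := by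
  funext t
  rw [sub_eq_add_neg]

/-- `v_x = ½ τ_x Φ + ½ τ_{-x} Φ` as functions. [folklore] -/
theorem phiAvg_eq (x : ℝ) :
    (fun t : ℝ => LagariasMontague.Psic (2 * (t + x)) + LagariasMontague.Psic (2 * (t - x))) =
      fun t : ℝ => (1 / 2 : ℂ) * ((2 : ℂ) * LagariasMontague.Psic (2 * (t + x))) +
        (1 / 2 : ℂ) * ((2 : ℂ) * LagariasMontague.Psic (2 * (t + -x))) := by
  funext t
  rw [sub_eq_add_neg]
  ring

/-! ## `v_x` is real, positive, even -/

/-- `v_x` is real-valued. [folklore] -/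
theorem phiAvg_im (x t : ℝ) :
    (LagariasMontague.Psic (2 * (t + x)) + LagariasMontague.Psic (2 * (t - x))).im = 0 := by
  simp [LagariasMontague.Psic]

/-- `v_x > 0` (`Ψ > 0` everywhere, `phi_re_pos`). [folklore] -/
theorem phiAvg_re_pos (x t : ℝ) :
    0 < (LagariasMontague.Psic (2 * (t + x)) + LagariasMontague.Psic (2 * (t - x))).re := by
  simp only [LagariasMontague.Psic, Complex.add_re, Complex.ofReal_re]
  have h1 := phi_re_pos (t + x)
  have h2 := phi_re_pos (t - x)
  linarith

/-- `v_x` is even (`Ψ` is even, `Psi_neg`). [folklore] -/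
theorem phiAvg_even (x t : ℝ) :
    LagariasMontague.Psic (2 * (-t + x)) + LagariasMontague.Psic (2 * (-t - x)) =
      LagariasMontague.Psic (2 * (t + x)) + LagariasMontague.Psic (2 * (t - x)) := by
  have e1 : 2 * (-t + x) = -(2 * (t - x)) := by ring
  have e2 : 2 * (-t - x) = -(2 * (t + x)) := by ring
  simp only [LagariasMontague.Psic, e1, e2, LagariasMontague.Psi_neg]
  ring

/-! ## Smoothness and the all-orders envelope at rate `1` -/

/-- `t ↦ Ψ(2(t + x₀))` is smooth. [folklore] -/
theorem phiAvg_psicTr_contDiff (x₀ : ℝ) :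
    ContDiff ℝ (⊤ : ℕ∞) (fun t : ℝ => LagariasMontague.Psic (2 * (t + x₀))) := by
  rw [phiAvg_psicTr_eq]
  exact contDiff_const.mul (phiTr_contDiff x₀)

/-- `v_x` is smooth. [folklore] -/
theorem phiAvg_contDiff (x : ℝ) :
    ContDiff ℝ (⊤ : ℕ∞)
      (fun t : ℝ => LagariasMontague.Psic (2 * (t + x)) + LagariasMontague.Psic (2 * (t - x))) := by
  rw [phiAvg_eq]
  exact (contDiff_const.mul (phiTr_contDiff x)).add (contDiff_const.mul (phiTr_contDiff (-x)))

/-- `(Ψ(2(· + x₀)))^{(n)}(t) = ½ Φ^{(n)}(t + x₀)` (`iteratedDeriv_comp_add_const`). [folklore] -/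
theorem phiAvg_iteratedDeriv_psicTr (x₀ : ℝ) (n : ℕ) (t : ℝ) :
    iteratedDeriv n (fun t : ℝ => LagariasMontague.Psic (2 * (t + x₀))) t =
      (1 / 2 : ℂ) *
        iteratedDeriv n (fun t : ℝ => (2 : ℂ) * LagariasMontague.Psic (2 * t)) (t + x₀) := by
  have h : iteratedDeriv n (fun z : ℝ => (2 : ℂ) * LagariasMontague.Psic (2 * (z + x₀))) t =
      iteratedDeriv n (fun u : ℝ => (2 : ℂ) * LagariasMontague.Psic (2 * u)) (t + x₀) :=
    congrFun (iteratedDeriv_comp_add_const n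
      (fun u : ℝ => (2 : ℂ) * LagariasMontague.Psic (2 * u)) x₀) t
  rw [← h, phiAvg_psicTr_eq, iteratedDeriv_const_mul_field (1 / 2 : ℂ)]

/-- `v_x^{(n)}(t) = ½ Φ^{(n)}(t + x) + ½ Φ^{(n)}(t - x)`. [folklore] -/
theorem phiAvg_iteratedDeriv_eq (x : ℝ) (n : ℕ) (t : ℝ) :
    iteratedDeriv n (fun t : ℝ => LagariasMontague.Psic (2 * (t + x)) +
        LagariasMontague.Psic (2 * (t - x))) t =
      (1 / 2 : ℂ) * iteratedDeriv n (fun t : ℝ => (2 : ℂ) * LagariasMontague.Psic (2 * t)) (t + x) +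
      (1 / 2 : ℂ) *
        iteratedDeriv n (fun t : ℝ => (2 : ℂ) * LagariasMontague.Psic (2 * t)) (t + -x) := by
  have hA : ∀ x₀ : ℝ, ContDiffAt ℝ n (fun t : ℝ => LagariasMontague.Psic (2 * (t + x₀))) t :=
    fun x₀ => ((phiAvg_psicTr_contDiff x₀).of_le (by exact_mod_cast le_top)).contDiffAt
  have hB : ContDiffAt ℝ n (fun t : ℝ => LagariasMontague.Psic (2 * (t - x))) t := by
    rw [phiAvg_psicTr_sub_eq]
    exact hA (-x)
  rw [iteratedDeriv_fun_add (hA x) hB, phiAvg_psicTr_sub_eq, phiAvg_iteratedDeriv_psicTr,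
    phiAvg_iteratedDeriv_psicTr]

/-- The translated rate-`1` envelope: `e^{-|t + x₀|} ≤ e^{|x₀|} e^{-|t|}`. [folklore] -/
theorem phiAvg_exp_translate_le (t x₀ : ℝ) :
    Real.exp (-(1 * |t + x₀|)) ≤ Real.exp |x₀| * Real.exp (-(1 * |t|)) := by
  rw [← Real.exp_add, Real.exp_le_exp]
  have h : |t| - |x₀| ≤ |t + x₀| := abs_sub_abs_le_abs_add t x₀
  linarith

/-- **All derivatives of `v_x` are `O(e^{-|t|})`**: `‖v_x^{(n)}(t)‖ ≤ C_n e^{|x|} e^{-|t|}`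
(`stub_phi_iteratedDeriv_envelope` at `t ± x`). [folklore] -/
theorem phiAvg_iteratedDeriv_bound (x : ℝ) (n : ℕ) :
    ∃ C : ℝ, ∀ t : ℝ,
      ‖iteratedDeriv n (fun t : ℝ => LagariasMontague.Psic (2 * (t + x)) +
        LagariasMontague.Psic (2 * (t - x))) t‖ ≤ C * Real.exp (-(1 * |t|)) := by
  obtain ⟨C, hC⟩ := stub_phi_iteratedDeriv_envelope n
  have hC0 : 0 ≤ C := by
    have h : (0 : ℝ) ≤ C * Real.exp (-(1 * |(0 : ℝ)|)) := (norm_nonneg _).trans (hC 0)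
    simpa using h
  refine ⟨C * Real.exp |x|, fun t => ?_⟩
  rw [phiAvg_iteratedDeriv_eq]
  have key : ∀ x₀ : ℝ, |x₀| = |x| →
      ‖(1 / 2 : ℂ) * iteratedDeriv n (fun t : ℝ => (2 : ℂ) * LagariasMontague.Psic (2 * t))
        (t + x₀)‖ ≤ C * Real.exp |x| * Real.exp (-(1 * |t|)) / 2 := by
    intro x₀ hx₀
    have h1 := hC (t + x₀)
    have h2 := phiAvg_exp_translate_le t x₀
    rw [hx₀] at h2
    have h3 : ‖(1 / 2 : ℂ)‖ = 1 / 2 := by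
      rw [norm_div, norm_one, Complex.norm_ofNat]
    rw [norm_mul, h3]
    calc 1 / 2 * ‖iteratedDeriv n (fun t : ℝ => (2 : ℂ) * LagariasMontague.Psic (2 * t)) (t + x₀)‖
        ≤ 1 / 2 * (C * Real.exp (-(1 * |t + x₀|))) := by gcongr
      _ ≤ 1 / 2 * (C * (Real.exp |x| * Real.exp (-(1 * |t|)))) := by gcongr
      _ = C * Real.exp |x| * Real.exp (-(1 * |t|)) / 2 := by ring
  calc _ ≤ ‖(1 / 2 : ℂ) * iteratedDeriv n (fun t : ℝ => (2 : ℂ) * LagariasMontague.Psic (2 * t))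
          (t + x)‖ + ‖(1 / 2 : ℂ) * iteratedDeriv n
            (fun t : ℝ => (2 : ℂ) * LagariasMontague.Psic (2 * t)) (t + -x)‖ := norm_add_le _ _
    _ ≤ C * Real.exp |x| * Real.exp (-(1 * |t|)) / 2 +
          C * Real.exp |x| * Real.exp (-(1 * |t|)) / 2 :=
        add_le_add (key x rfl) (key (-x) (abs_neg x))
    _ = C * Real.exp |x| * Real.exp (-(1 * |t|)) := by ring

/-! ## The envelope at every rate -/

/-- **`v_x = O(e^{-b|t|})` for EVERY rate `b`** (super-exponential decay of `Ψ`, `stub_psiDecay`,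
at rate `|b|`: `e^{-2|b||t ± x|} ≤ e^{2|b||x|} e^{-b|t|}`). [folklore] -/
theorem phiAvg_bound (x b : ℝ) :
    ∃ C : ℝ, ∀ t : ℝ,
      ‖LagariasMontague.Psic (2 * (t + x)) + LagariasMontague.Psic (2 * (t - x))‖ ≤
        C * Real.exp (-(b * |t|)) := by
  obtain ⟨C, hC⟩ := stub_psiDecay.1 |b|
  have hC0 : 0 ≤ C := by
    have h : (0 : ℝ) ≤ C * Real.exp (-(|b| * |(0 : ℝ)|)) := (abs_nonneg _).trans (hC 0)
    simpa using h
  refine ⟨2 * (C * Real.exp (2 * |b| * |x|)), fun t => ?_⟩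
  have key : ∀ x₀ : ℝ, |x₀| = |x| →
      ‖LagariasMontague.Psic (2 * (t + x₀))‖ ≤
        C * Real.exp (2 * |b| * |x|) * Real.exp (-(b * |t|)) := by
    intro x₀ hx₀
    rw [LagariasMontague.Psic, Complex.norm_real, Real.norm_eq_abs]
    refine (hC _).trans ?_
    rw [mul_assoc]
    refine mul_le_mul_of_nonneg_left ?_ hC0
    rw [← Real.exp_add, Real.exp_le_exp, abs_mul, abs_two]
    have h1 : |t| - |x₀| ≤ |t + x₀| := abs_sub_abs_le_abs_add t x₀
    rw [hx₀] at h1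
    have h2 : b * |t| ≤ 2 * |b| * |t| :=
      mul_le_mul_of_nonneg_right (by linarith [le_abs_self b, abs_nonneg b]) (abs_nonneg t)
    nlinarith [mul_le_mul_of_nonneg_left h1 (abs_nonneg b), abs_nonneg b, abs_nonneg x]
  calc ‖LagariasMontague.Psic (2 * (t + x)) + LagariasMontague.Psic (2 * (t - x))‖
      ≤ ‖LagariasMontague.Psic (2 * (t + x))‖ + ‖LagariasMontague.Psic (2 * (t - x))‖ :=
        norm_add_le _ _
    _ ≤ C * Real.exp (2 * |b| * |x|) * Real.exp (-(b * |t|)) +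
          C * Real.exp (2 * |b| * |x|) * Real.exp (-(b * |t|)) := by
        refine add_le_add (key x rfl) ?_
        have h := key (-x) (abs_neg x)
        rwa [← sub_eq_add_neg] at h
    _ = 2 * (C * Real.exp (2 * |b| * |x|)) * Real.exp (-(b * |t|)) := by ring

/-! ## The Mellin transform `v̂_x(s) = cosh((s - 1/2)x) ξ(s)` -/

/-- The Mellin integrand of the translate `τ_{x₀}Φ` is integrable for every `s` (translate of the
integrable integrand of `Φ`, `integrable_phi_mul_cexp`). [folklore] -/
theorem phiAvg_integrable_phiTr_mul_cexp (x₀ : ℝ) (s : ℂ) :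
    Integrable fun t : ℝ =>
      (2 : ℂ) * LagariasMontague.Psic (2 * (t + x₀)) * cexp ((s - 1 / 2) * t) := by
  have h := ((integrable_phi_mul_cexp stub_psiDecay.2 s).comp_add_right x₀).const_mul
    (cexp (-((s - 1 / 2) * x₀)))
  refine h.congr (ae_of_all _ fun t => ?_)
  dsimp only
  have e : cexp ((s - 1 / 2) * ((t + x₀ : ℝ) : ℂ)) =
      cexp ((s - 1 / 2) * x₀) * cexp ((s - 1 / 2) * t) := by
    rw [← Complex.exp_add]
    congr 1
    push_cast
    ring
  have e' : cexp (-((s - 1 / 2) * (x₀ : ℂ))) * cexp ((s - 1 / 2) * x₀) = 1 := by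
    rw [← Complex.exp_add, neg_add_cancel, Complex.exp_zero]
  rw [e]
  calc cexp (-((s - 1 / 2) * (x₀ : ℂ))) * (2 * LagariasMontague.Psic (2 * (t + x₀)) *
        (cexp ((s - 1 / 2) * x₀) * cexp ((s - 1 / 2) * t)))
      = cexp (-((s - 1 / 2) * (x₀ : ℂ))) * cexp ((s - 1 / 2) * x₀) *
          (2 * LagariasMontague.Psic (2 * (t + x₀)) * cexp ((s - 1 / 2) * t)) := by ring
    _ = 2 * LagariasMontague.Psic (2 * (t + x₀)) * cexp ((s - 1 / 2) * t) := by
        rw [e', one_mul]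

/-- **`v̂_x(s) = cosh((s - 1/2)x) ξ(s)`** for every `s : ℂ`: `v_x = ½ τ_x Φ + ½ τ_{-x} Φ` and
`(τ_{t₀}Φ)^(s) = e^{-(s-1/2)t₀} ξ(s)` (`phiTr_weilMellin`). [folklore] -/
theorem phiAvg_weilMellin (x : ℝ) (s : ℂ) :
    weilMellin (fun t : ℝ => LagariasMontague.Psic (2 * (t + x)) +
        LagariasMontague.Psic (2 * (t - x))) s =
      Complex.cosh ((s - 1 / 2) * (x : ℂ)) * riemannXi s := by
  have h1 := phiTr_weilMellin x s
  have h2 := phiTr_weilMellin (-x) s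
  unfold weilMellin at h1 h2 ⊢
  have h2' : ∫ t : ℝ, 2 * LagariasMontague.Psic (2 * (t + -x)) * cexp ((s - 1 / 2) * t) =
      cexp ((s - 1 / 2) * x) * riemannXi s := by
    rw [h2]
    congr 2
    push_cast
    ring
  have e : ∀ t : ℝ, (LagariasMontague.Psic (2 * (t + x)) + LagariasMontague.Psic (2 * (t - x))) *
      cexp ((s - 1 / 2) * t) =
      (1 / 2 : ℂ) * ((2 : ℂ) * LagariasMontague.Psic (2 * (t + x)) * cexp ((s - 1 / 2) * t)) +
      (1 / 2 : ℂ) * ((2 : ℂ) * LagariasMontague.Psic (2 * (t + -x)) * cexp ((s - 1 / 2) * t)) := by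
    intro t
    rw [sub_eq_add_neg t x]
    ring
  simp_rw [e]
  rw [integral_add ((phiAvg_integrable_phiTr_mul_cexp x s).const_mul _)
    ((phiAvg_integrable_phiTr_mul_cexp (-x) s).const_mul _), integral_const_mul,
    integral_const_mul, h1, h2', Complex.cosh]
  ring

/-! ## Weil-harmonicity `W(v_x ⋆ g̃) = 0` -/

/-- `v_x` is weighted-`L¹` at rate `1`: `∫ ‖v_x‖ e^{|t|} < ∞` (`v_x = O(e^{-2|t|})`). [folklore] -/
theorem phiAvg_integrable_weight (x : ℝ) :
    Integrable (fun t : ℝ => ‖LagariasMontague.Psic (2 * (t + x)) +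
      LagariasMontague.Psic (2 * (t - x))‖ * Real.exp (1 * |t|)) := by
  obtain ⟨C, hC⟩ := phiAvg_bound x 2
  refine ((Literature.Analysis.Complex.integrable_exp_neg_mul_abs one_pos).const_mul C).mono'
    (((phiAvg_contDiff x).continuous.norm.mul (by fun_prop)).aestronglyMeasurable)
    (ae_of_all _ fun t => ?_)
  rw [Real.norm_of_nonneg (by positivity)]
  calc ‖LagariasMontague.Psic (2 * (t + x)) + LagariasMontague.Psic (2 * (t - x))‖ *
        Real.exp (1 * |t|) ≤ C * Real.exp (-(2 * |t|)) * Real.exp (1 * |t|) :=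
        mul_le_mul_of_nonneg_right (hC t) (Real.exp_pos _).le
    _ = C * Real.exp (-1 * |t|) := by
        rw [mul_assoc, ← Real.exp_add]
        congr 2
        ring

/-- **`v_x` is Weil-harmonic (RH-free)**: `W(v_x ⋆ g̃) = 0` for every Weil test function `g`.
By the strong-class pairing (`stub_strongClass_pairing`, `g` lies in the strong class at rate `1`,
`hExt_strong_of_isWeilTest`) `v_x ⋆ g̃` lies in the exponential class with
`(v_x ⋆ g̃)^(s) = v̂_x(s) conj ĝ(1 - conj s)` in the closed strip, and by the class explicit formula
`W(v_x ⋆ g̃) = Σ'_ρ m(ρ) cosh((ρ - 1/2)x) ξ(ρ) conj ĝ(1 - conj ρ) = 0` (`ξ(ρ) = 0`). [folklore] -/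
theorem phiAvg_conv_harmonic (x : ℝ) {g : ℝ → ℂ} (hg : IsWeilTest g) :
    weilFunctional (weilConv (fun t : ℝ => LagariasMontague.Psic (2 * (t + x)) +
      LagariasMontague.Psic (2 * (t - x))) (weilReflect g)) = 0 := by
  have hv : AEStronglyMeasurable (fun t : ℝ => LagariasMontague.Psic (2 * (t + x)) +
      LagariasMontague.Psic (2 * (t - x))) volume :=
    (phiAvg_contDiff x).continuous.aestronglyMeasurable
  obtain ⟨hFcd, hFbd, hFmel⟩ := stub_strongClass_pairing _ g 1 1 hv (by norm_num)
    (phiAvg_integrable_weight x) hg.1 (by norm_num) le_rfl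
    (fun k => hExt_strong_of_isWeilTest hg (by norm_num) k)
  obtain ⟨C, hC0, hC1, hC2⟩ := hExt_deriv_bounds_of_all hFbd
  obtain ⟨-, hsum⟩ := explicit_formula_expClass' _ C 1 hFcd (by norm_num) hC0 hC1 hC2
  rw [← hsum]
  refine (tsum_congr fun ρ => ?_).trans tsum_zero
  have hρ0 := ZetaZeros.riemannZetaNontrivialZeros.re_pos ρ.2
  have hρ1 := ZetaZeros.riemannZetaNontrivialZeros.re_lt_one ρ.2
  rw [hFmel ρ hρ0.le hρ1.le, phiAvg_weilMellin,
    riemannXi_eq_zero_of_mem_riemannZetaNontrivialZeros ρ.2]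
  simp

/-! ## `v_x` is not a multiple of `Φ` -/

/-- **Non-rigidity: for `x ≠ 0`, `v_x` is not a multiple of `Φ`.**  If `v_x = c Φ` then
`cosh((s - 1/2)x) ξ(s) = c ξ(s)` for all `s`; `s = 1/2` gives `c = 1` (`ξ(1/2) ≠ 0`), and `s = 0`
gives `cosh(x/2) = 1` (`ξ(0) = 1/2`), i.e. `x = 0` (`Real.one_lt_cosh`). [folklore] -/
theorem phiAvg_not_multiple {x : ℝ} (hx : x ≠ 0) (c : ℂ) :
    ¬ ∀ t : ℝ, LagariasMontague.Psic (2 * (t + x)) + LagariasMontague.Psic (2 * (t - x)) =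
      c * (2 * LagariasMontague.Psic (2 * t)) := by
  intro h
  have hfun : (fun t : ℝ => LagariasMontague.Psic (2 * (t + x)) +
      LagariasMontague.Psic (2 * (t - x))) = fun t : ℝ => c * (2 * LagariasMontague.Psic (2 * t)) :=
    funext h
  have hmel : ∀ s : ℂ, Complex.cosh ((s - 1 / 2) * (x : ℂ)) * riemannXi s = c * riemannXi s := by
    intro s
    rw [← phiAvg_weilMellin, hfun, weilMellin_const_mul,
      stub_mellinXi stub_psiDecay.1 stub_psiDecay.2]
  have hc : c = 1 := by
    have h1 := hmel (1 / 2)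
    rw [sub_self, zero_mul, Complex.cosh_zero] at h1
    exact ((mul_left_inj' riemannXi_one_half_ne_zero).1 h1).symm
  have h0 := hmel 0
  rw [hc, one_mul, riemannXi_zero, zero_sub] at h0
  have h0' : Complex.cosh (-(1 / 2) * (x : ℂ)) = 1 :=
    (mul_left_inj' (by norm_num : (1 / 2 : ℂ) ≠ 0)).1 (h0.trans (one_mul _).symm)
  have h2 : Complex.cosh (-(1 / 2) * (x : ℂ)) = (Real.cosh (x / 2) : ℂ) := by
    rw [Complex.ofReal_cosh, ← Complex.cosh_neg]
    congr 1
    push_cast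
    ring
  rw [h2] at h0'
  have h3 : Real.cosh (x / 2) = 1 := by exact_mod_cast h0'
  have h4 : 1 < Real.cosh (x / 2) := Real.one_lt_cosh.2 (div_ne_zero hx two_ne_zero)
  linarith

/-! ## The stub -/

/-- **Stub H6 — `phi_translateAvg_harmonic` (RH-free): the symmetrised translate
`v_x(t) = Ψ(2(t + x)) + Ψ(2(t - x)) = (Φ(t + x) + Φ(t - x))/2` of Riemann's kernel `Φ = 2Ψ(2·)`
shares every structural property of `Φ` visible to the explicit formula, yet is not a multiple of
`Φ`.**  It is real (`Im = 0`), positive, even, smooth; all its derivatives are `O(e^{-|t|})`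
(`stub_phi_iteratedDeriv_envelope` + `iteratedDeriv_comp_add_const`) and it is `O(e^{-b|t|})` for
every rate `b` (`stub_psiDecay`); its transform is `v̂_x(s) = cosh((s - 1/2)x) ξ(s)`
(`phiTr_weilMellin` at `±x`), which vanishes at every non-trivial zero, so `W(v_x ⋆ g̃) = 0` for
every test `g` (`stub_strongClass_pairing` + `explicit_formula_expClass'`); and for `x ≠ 0` no
`c` has `v_x = c Φ` (else `c = 1` at `s = 1/2` by `ξ(1/2) ≠ 0` and `cosh(x/2) = 1` at `s = 0` by
`ξ(0) = 1/2`). [folklore] -/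
theorem stub_phi_translateAvg_harmonic :
    ∀ x : ℝ,
      (∀ t : ℝ, (LagariasMontague.Psic (2 * (t + x)) + LagariasMontague.Psic (2 * (t - x))).im = 0) ∧
      (∀ t : ℝ, 0 < (LagariasMontague.Psic (2 * (t + x)) + LagariasMontague.Psic (2 * (t - x))).re) ∧
      (∀ t : ℝ, LagariasMontague.Psic (2 * (-t + x)) + LagariasMontague.Psic (2 * (-t - x)) =
        LagariasMontague.Psic (2 * (t + x)) + LagariasMontague.Psic (2 * (t - x))) ∧
      ContDiff ℝ (⊤ : ℕ∞)
        (fun t : ℝ => LagariasMontague.Psic (2 * (t + x)) + LagariasMontague.Psic (2 * (t - x))) ∧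
      (∀ n : ℕ, ∃ C : ℝ, ∀ t : ℝ,
        ‖iteratedDeriv n (fun t : ℝ => LagariasMontague.Psic (2 * (t + x)) +
          LagariasMontague.Psic (2 * (t - x))) t‖ ≤ C * Real.exp (-(1 * |t|))) ∧
      (∀ b : ℝ, ∃ C : ℝ, ∀ t : ℝ,
        ‖LagariasMontague.Psic (2 * (t + x)) + LagariasMontague.Psic (2 * (t - x))‖ ≤
          C * Real.exp (-(b * |t|))) ∧
      (∀ s : ℂ, weilMellin (fun t : ℝ => LagariasMontague.Psic (2 * (t + x)) +
          LagariasMontague.Psic (2 * (t - x))) s =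
        Complex.cosh ((s - 1 / 2) * (x : ℂ)) * riemannXi s) ∧
      (∀ g : ℝ → ℂ, IsWeilTest g →
        weilFunctional (weilConv (fun t : ℝ => LagariasMontague.Psic (2 * (t + x)) +
          LagariasMontague.Psic (2 * (t - x))) (weilReflect g)) = 0) ∧
      (x ≠ 0 → ∀ c : ℂ, ¬ ∀ t : ℝ, LagariasMontague.Psic (2 * (t + x)) +
          LagariasMontague.Psic (2 * (t - x)) = c * (2 * LagariasMontague.Psic (2 * t))) := by
  intro x
  exact ⟨phiAvg_im x, phiAvg_re_pos x, phiAvg_even x, phiAvg_contDiff x,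
    phiAvg_iteratedDeriv_bound x, phiAvg_bound x, phiAvg_weilMellin x,
    fun g hg => phiAvg_conv_harmonic x hg, fun hx c => phiAvg_not_multiple hx c⟩

end Summit.RiemannHypothesis.RiemannHypothesis.Theorems.GroundStatesConvergeToXi

end
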